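import Literature.Analysis.FluidPDE.ClassicalSupStabilityForced
import Literature.Analysis.FluidPDE.KatoBilinearEstimates
import Literature.Analysis.FluidPDE.ClassicalSolutionGlue
import HarnessLib

/-!
# `L² → L^∞` smoothing of the gap between two bounded classical solutions of the forced
# Navier–Stokes system on `ℝ³` over a short slab

Analysis/FluidPDE proof file (theorems only; no definitions, no named facts, no `sorry`). It is the
SHORT-TIME SMOOTHING twin of the tree's sup-norm stability theorem `sup_stability_forced_core`
(`ClassicalSupStabilityForced.lean`): there the gap of the data is measured in the sup norm
(`‖u'(0) − u(0)‖ ≤ D`); here it is measured in `L²` only (`‖u'(0) − u(0)‖₂ ≤ E₀`), and the heat flow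
smooths it into a sup-norm gap `E₀ (ν t)^{-3/4}` at positive times.

Let `(u, p)` and `(u', p')` be classical solutions of the Navier–Stokes system on the closed slab
`[0, T] × ℝ³` with the same viscosity `ν > 0`, driven by jointly continuous, bounded, weakly
divergence-free forces `g`, `g'` with square-integrable slices, both of finite energy and bounded:
`‖u‖ ≤ M`, `‖u'‖ ≤ M'` on the slab. Suppose the slab is SHORT,

  `(24 C₀ (M + M'))² · T ≤ ν`,   `C₀ = oseenSliceConst ℝ³`,

that `‖u'(0) − u(0)‖_{L²} ≤ E₀`, and that the heat Duhamel integrals of the two forces differ by at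
most `F` on the slab. Then for all `t ∈ (0, T]` and every `x`

  `‖u'(t, x) − u(t, x)‖ ≤ 2 (E₀ ν^{-3/4} + F T^{3/4}) · t^{-3/4}`
  `                    = 2 (E₀ (ν t)^{-3/4} + F (T/t)^{3/4})`

(`sup_stability_forced_smoothing_core`), with the corollaries `sup_stability_forced_smoothing`
(forces measured in the sup norm, `F = TΔ`), `sup_stability_forced_smoothing_free` (`u` unforced,
`g'` measured in `L²`: `F = 4 ν^{-3/4} T^{1/4} sup_t ‖g'(t)‖₂` — the shape an a-posteriori /
certificate argument consumes, `u` an exact free run and `u'` a pseudo-run driven by its own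
defect), `sup_stability_smoothing_unforced` (two unforced solutions, `F = 0`:
`‖u'(t,x) − u(t,x)‖ ≤ 2 E₀ (ν t)^{-3/4}`), and the TERMINAL-WINDOW form
`sup_stability_forced_smoothing_free_window` on `[s, T]` from the `L²` gap at time `s`.

A remark on constants: the shortness hypothesis and all sup-norm stability statements of this
family are in terms of the slice constant `C₀ = oseenSliceConst ℝ³`, which the tree bounds from
BELOW only (`inv_sqrt_pi_le_oseenSliceConst`); a numerical certificate consuming this file needs an
explicit UPPER bound for `C₀`, which is not in the tree at the time of writing.

Mechanism (Leray 1934, §19: a-priori control of the sup norm through the integral equation, with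
the smoothing `‖e^{σΔ} f‖_∞ ≤ ‖f‖₂ σ^{-3/4}` of the free term, Ożański–Pooley 2018 (6.65)): subtract
the forced Oseen representations of the two solutions (`IsClassicalNSSolutionOn.ae_eq_forced_oseenMild`),
bound the free term by `norm_heatExtension_le_of_eLpNorm_two`, split the bilinear terms
`B(u',u') − B(u,u) = B(u', w) + B(w, u)` (`w = u' − u`), and close in the weighted sup norm
`sup_{t,x} t^{3/4} ‖w(t,x)‖` (finite a priori because both solutions are bounded): the bilinear terms
are bounded by the slice estimate `‖N_σ[a,b]‖ ≤ C₀ σ^{-1/2} ‖a‖_∞ ‖b‖_∞` against the weight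
`τ^{-3/4}`, i.e. by the Beta-type integral `∫₀ᵗ (t−τ)^{-1/2} τ^{-3/4} dτ = t^{-1/4} B(1/2, 1/4)`
(`setIntegral_Ioo_sub_rpow_mul_rpow`; here `B(1/2,1/4) = ∫₀¹ (1−s)^{-1/2} s^{-3/4} ds ≤ 12`,
`integral_one_sub_rpow_half_mul_rpow_threeQuarter_le`), and `t^{3/4} · t^{-1/4} = t^{1/2} ≤ T^{1/2}`
is absorbed by the shortness of the slab. No continuity in time of any norm is used.

Consumer: the cell `ns-blowup` (route `PalasekTowerBreakdown`, crux `EpisodeBase`,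
stmt-NavierStokesRegularity-19179), certificate road (ii): an `L²`-gap between an exact run and a
certified approximate run, obtained cheaply over a long window (energy / strain-rate currency), is
upgraded to the SUP-norm gap the readouts of `palasekTowerBreakdown_episodeBase_of_lineGerm_nearFreeRun`
consume, by applying this file on the short terminal slab `[t − h, t]` of each readout time (time
translation `IsClassicalNSSolutionOn.comp_add_right`, `sup_stability_forced_smoothing_free_window`); the sup-norm Gronwall fee of
`sup_stability_forced_core` is then paid over `h` only. LABEL: Literature port (a-priori estimate
for GIVEN solutions). WHAT THIS IS NOT: not a statement about Navier–Stokes regularity or blow-up —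
continuous dependence over a FIXED short slab for solutions assumed classical and bounded there.

## Mathlib / tree search

Tree: `sup_stability_forced_core`, `norm_oseenDuhamel_le_setIntegral_visc`,
`forceDuhamel_sub_of_continuous` (`ClassicalSupStabilityForced`); `norm_heatExtension_le_of_eLpNorm_two`
(`OseenDuhamelEnergyBound`); `one_sub_rpow_mul_rpow_le`, `intervalIntegrable_sub_rpow_mul_rpow`,
`setIntegral_Ioo_sub_rpow_mul_rpow` (`KatoBilinearEstimates`); `IsClassicalNSSolutionOn.ae_eq_forced_oseenMild`;
`oseenDuhamel_sub_left/right`; `UnboundedOperators.heatExtension_sub_of_bound`;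
`forall_norm_le_of_ae_norm_le`. No `L² → L^∞` statement for the DIFFERENCE of two Navier–Stokes
solutions existed (`ClassicalSupStability{Forced,Mild,Bootstrap,MildBootstrap}` all take sup-norm data;
`lean search 'smoothing|eLpNorm_two.*sub'` in FluidPDE).

## References

* J. Leray, *Sur le mouvement d'un liquide visqueux emplissant l'espace*, Acta Math. 63 (1934),
  §19 (3.4)–(3.8). [Leray1934]
* W. S. Ożański, B. C. Pooley, *Leray's fundamental work on the Navier–Stokes equations*, LMS
  Lecture Note Ser. 452 (2018), (6.65) p. 143 and Lemma 6.5. [OzanskiPooley2018]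
* P. G. Lemarié-Rieusset, *The Navier–Stokes Problem in the 21st Century*, CRC Press 2016, Thm. 6.1
  (6.12) with Prop. 6.5. [LemarieRieusset2016]
* G. Koch, N. Nadirashvili, G. Seregin, V. Šverák, Acta Math. 203 (2009), §3 (3.5).
  [KochNadirashviliSereginSverak2009]
-/

noncomputable section

open MeasureTheory Set Function Filter
open _root_.Topology
open scoped ENNReal NNReal

namespace Literature.Analysis.FluidPDE

/-! ### Calculus: the Beta integral `B(1/2, 1/4)` and the Abel integral against `τ^{-3/4}` -/

section Calculus

/-- **A numerical bound for the Beta integral `∫₀¹ (1−s)^{-1/2} s^{-3/4} ds ≤ 12`** (its value is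
`B(1/4, 1/2) = Γ(1/4)Γ(1/2)/Γ(3/4) ≈ 5.24`): split at `s = 1/2` (`one_sub_rpow_mul_rpow_le`:
`(1−s)^{-1/2} s^{-3/4} ≤ 2^{1/2} s^{-3/4} + 2^{3/4} (1−s)^{-1/2}`), bound `2^{1/2}, 2^{3/4} ≤ 2`, and
integrate `∫₀¹ s^{-3/4} = 4`, `∫₀¹ (1−s)^{-1/2} = 2`. [folklore] -/
private theorem integral_one_sub_rpow_half_mul_rpow_threeQuarter_le :
    ∫ s in (0 : ℝ)..1, (1 - s) ^ (-(1 / 2 : ℝ)) * s ^ (-(3 / 4 : ℝ)) ≤ 12 := by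
  have hI : IntervalIntegrable (fun s : ℝ => (1 - s) ^ (-(1 / 2 : ℝ)) * s ^ (-(3 / 4 : ℝ))) volume 0 1 :=
    intervalIntegrable_one_sub_rpow_mul_rpow (a := 1 / 2) (b := 3 / 4) (by norm_num) (by norm_num)
      (by norm_num) (by norm_num)
  have h1 : IntervalIntegrable (fun s : ℝ => s ^ (-(3 / 4 : ℝ))) volume 0 1 :=
    intervalIntegral.intervalIntegrable_rpow' (by norm_num)
  have h2 : IntervalIntegrable (fun s : ℝ => (1 - s) ^ (-(1 / 2 : ℝ))) volume 0 1 := by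
    have h := (intervalIntegral.intervalIntegrable_rpow' (a := 0) (b := 1) (r := -(1 / 2 : ℝ))
      (by norm_num)).comp_sub_left 1
    simp only [sub_zero, sub_self] at h
    exact h.symm
  have h2a : (2 : ℝ) ^ (1 / 2 : ℝ) ≤ 2 := by
    conv_rhs => rw [← Real.rpow_one 2]
    exact Real.rpow_le_rpow_of_exponent_le (by norm_num) (by norm_num)
  have h2b : (2 : ℝ) ^ (3 / 4 : ℝ) ≤ 2 := by
    conv_rhs => rw [← Real.rpow_one 2]
    exact Real.rpow_le_rpow_of_exponent_le (by norm_num) (by norm_num)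
  have hmono : ∫ s in (0 : ℝ)..1, (1 - s) ^ (-(1 / 2 : ℝ)) * s ^ (-(3 / 4 : ℝ)) ≤
      ∫ s in (0 : ℝ)..1, (2 * s ^ (-(3 / 4 : ℝ)) + 2 * (1 - s) ^ (-(1 / 2 : ℝ))) := by
    refine intervalIntegral.integral_mono_on_of_le_Ioo zero_le_one hI
      ((h1.const_mul 2).add (h2.const_mul 2)) fun s hs => ?_
    have h := one_sub_rpow_mul_rpow_le (a := 1 / 2) (b := 3 / 4) (by norm_num) (by norm_num) hs
    have hs1 : 0 ≤ s ^ (-(3 / 4 : ℝ)) := Real.rpow_nonneg hs.1.le _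
    have hs2 : 0 ≤ (1 - s) ^ (-(1 / 2 : ℝ)) := Real.rpow_nonneg (by linarith [hs.2]) _
    calc (1 - s) ^ (-(1 / 2 : ℝ)) * s ^ (-(3 / 4 : ℝ))
        ≤ 2 ^ (1 / 2 : ℝ) * s ^ (-(3 / 4 : ℝ)) + 2 ^ (3 / 4 : ℝ) * (1 - s) ^ (-(1 / 2 : ℝ)) := h
      _ ≤ 2 * s ^ (-(3 / 4 : ℝ)) + 2 * (1 - s) ^ (-(1 / 2 : ℝ)) := by gcongr
  have i1 : ∫ s in (0 : ℝ)..1, s ^ (-(3 / 4 : ℝ)) = 4 := by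
    rw [integral_rpow (Or.inl (by norm_num))]
    rw [show (-(3 / 4 : ℝ) + 1) = 1 / 4 by norm_num, Real.one_rpow, Real.zero_rpow (by norm_num)]
    norm_num
  have i2 : ∫ s in (0 : ℝ)..1, (1 - s) ^ (-(1 / 2 : ℝ)) = 2 := by
    rw [intervalIntegral.integral_comp_sub_left (fun x : ℝ => x ^ (-(1 / 2 : ℝ))) 1]
    simp only [sub_self, sub_zero]
    rw [integral_rpow (Or.inl (by norm_num))]
    rw [show (-(1 / 2 : ℝ) + 1) = 1 / 2 by norm_num, Real.one_rpow, Real.zero_rpow (by norm_num)]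
    norm_num
  have hsum : ∫ s in (0 : ℝ)..1, (2 * s ^ (-(3 / 4 : ℝ)) + 2 * (1 - s) ^ (-(1 / 2 : ℝ))) = 12 := by
    rw [intervalIntegral.integral_add (h1.const_mul 2) (h2.const_mul 2),
      intervalIntegral.integral_const_mul, intervalIntegral.integral_const_mul, i1, i2]
    norm_num
  exact hmono.trans hsum.le

/-- **The Abel integral against the weight `τ^{-3/4}` at viscosity `ν`**: for `ν > 0`, `t > 0` and
a constant `K ≥ 0`, the integrand `(ν(t−τ))^{-1/2} · (K τ^{-3/4})` is integrable on `(0, t)` and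
`∫_{(0,t)} (ν(t−τ))^{-1/2} (K τ^{-3/4}) dτ ≤ K ν^{-1/2} · 12 t^{-1/4}` (Beta scaling
`∫₀ᵗ (t−τ)^{-1/2} τ^{-3/4} dτ = t^{-1/4} ∫₀¹ (1−s)^{-1/2} s^{-3/4} ds`). [folklore] -/
private theorem setIntegral_visc_abelKernel_mul_rpow_threeQuarter_le {ν t K : ℝ} (hν : 0 < ν) (ht : 0 < t)
    (hK : 0 ≤ K) :
    IntegrableOn (fun τ => (ν * (t - τ)) ^ (-(1 / 2 : ℝ)) * (K * τ ^ (-(3 / 4 : ℝ)))) (Ioo 0 t) ∧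
    ∫ τ in Ioo 0 t, (ν * (t - τ)) ^ (-(1 / 2 : ℝ)) * (K * τ ^ (-(3 / 4 : ℝ))) ≤
      K * ν ^ (-(1 / 2 : ℝ)) * (12 * t ^ (-(1 / 4 : ℝ))) := by
  -- the integrand, rewritten on `(0, t)`
  have heqOn : EqOn (fun τ => (ν * (t - τ)) ^ (-(1 / 2 : ℝ)) * (K * τ ^ (-(3 / 4 : ℝ))))
      (fun τ => (K * ν ^ (-(1 / 2 : ℝ))) * ((t - τ) ^ (-(1 / 2 : ℝ)) * τ ^ (-(3 / 4 : ℝ))))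
      (Ioo 0 t) := by
    intro τ hτ
    simp only
    rw [Real.mul_rpow hν.le (sub_nonneg.2 hτ.2.le)]
    ring
  have hfI : IntegrableOn (fun τ : ℝ => (t - τ) ^ (-(1 / 2 : ℝ)) * τ ^ (-(3 / 4 : ℝ))) (Ioo 0 t) := by
    have h := intervalIntegrable_sub_rpow_mul_rpow (a := 1 / 2) (b := 3 / 4) (by norm_num)
      (by norm_num) (by norm_num) (by norm_num) ht
    rwa [intervalIntegrable_iff_integrableOn_Ioo_of_le ht.le] at h
  have hI : IntegrableOn
      (fun τ => (K * ν ^ (-(1 / 2 : ℝ))) * ((t - τ) ^ (-(1 / 2 : ℝ)) * τ ^ (-(3 / 4 : ℝ))))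
      (Ioo 0 t) := hfI.const_mul _
  refine ⟨hI.congr_fun heqOn.symm measurableSet_Ioo, ?_⟩
  rw [setIntegral_congr_fun measurableSet_Ioo heqOn, integral_const_mul,
    setIntegral_Ioo_sub_rpow_mul_rpow (a := 1 / 2) (b := 3 / 4) ht,
    show (1 : ℝ) - 1 / 2 - 3 / 4 = -(1 / 4 : ℝ) by norm_num]
  have hKν : 0 ≤ K * ν ^ (-(1 / 2 : ℝ)) := mul_nonneg hK (Real.rpow_nonneg hν.le _)
  have ht4 : 0 ≤ t ^ (-(1 / 4 : ℝ)) := Real.rpow_nonneg ht.le _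
  have hB := integral_one_sub_rpow_half_mul_rpow_threeQuarter_le
  calc K * ν ^ (-(1 / 2 : ℝ)) *
        (t ^ (-(1 / 4 : ℝ)) * ∫ s in (0 : ℝ)..1, (1 - s) ^ (-(1 / 2 : ℝ)) * s ^ (-(3 / 4 : ℝ)))
      ≤ K * ν ^ (-(1 / 2 : ℝ)) * (t ^ (-(1 / 4 : ℝ)) * 12) := by gcongr
    _ = K * ν ^ (-(1 / 2 : ℝ)) * (12 * t ^ (-(1 / 4 : ℝ))) := by ring

end Calculus

/-! ### The core estimate -/

section Core

variable {ν T M M' E₀ F : ℝ}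
  {g g' u u' : ℝ → EuclideanSpace ℝ (Fin 3) → EuclideanSpace ℝ (Fin 3)}
  {p p' : ℝ → EuclideanSpace ℝ (Fin 3) → ℝ} {G G' : ℝ} {G₂ G₂' : ℝ≥0∞}

/-- **`L² → L^∞` smoothing of the gap between two bounded classical finite-energy solutions of the
forced Navier–Stokes system on a short slab (core form).** Let `(u, p)`, `(u', p')` be classical
solutions on `[0, T] × ℝ³` (`ν > 0`, `T > 0`) driven by jointly continuous forces `g`, `g'` whose
slices are bounded, weakly divergence free and square integrable (`‖g(τ)‖₂ ≤ G₂ < ∞`,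
`‖g'(τ)‖₂ ≤ G₂' < ∞`), both of finite energy and bounded, `‖u‖ ≤ M`, `‖u'‖ ≤ M'` (`M, M' > 0`), on a
SHORT slab: `(24 C₀ (M + M'))² T ≤ ν`, `C₀ = oseenSliceConst ℝ³`. If the data differ by at most `E₀`
in `L²` (`‖u'(0,·) − u(0,·)‖₂ ≤ E₀`, NO sup-norm hypothesis on the gap) and the heat Duhamel integrals
of the forces differ by at most `F` on `(0, T]`, then for all `t ∈ (0, T]` and all `x`:
`‖u'(t,x) − u(t,x)‖ ≤ 2 (E₀ ν^{-3/4} + F T^{3/4}) t^{-3/4} = 2 (E₀ (νt)^{-3/4} + F (T/t)^{3/4})`.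
[cite: Leray1934, §19 (3.4)–(3.8)] [cite: OzanskiPooley2018, (6.65) p. 143 and Lemma 6.5]
[cite: LemarieRieusset2016, Thm. 6.1 (6.12) with Prop. 6.5] -/
theorem sup_stability_forced_smoothing_core (hν : 0 < ν) (hT : 0 < T)
    (hcl : IsClassicalNSSolutionOn (Icc 0 T) ν g u p)
    (hcl' : IsClassicalNSSolutionOn (Icc 0 T) ν g' u' p')
    (hgc : Continuous (uncurry g)) (hg'c : Continuous (uncurry g'))
    (hG : ∀ τ ∈ Icc 0 T, ∀ y, ‖g τ y‖ ≤ G) (hG' : ∀ τ ∈ Icc 0 T, ∀ y, ‖g' τ y‖ ≤ G')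
    (hgdiv : ∀ τ ∈ Icc 0 T, IsWeaklyDivFree (g τ)) (hg'div : ∀ τ ∈ Icc 0 T, IsWeaklyDivFree (g' τ))
    (hG₂ : G₂ ≠ ⊤) (hG₂' : G₂' ≠ ⊤)
    (hg2 : ∀ τ ∈ Icc 0 T, eLpNorm (g τ) 2 volume ≤ G₂)
    (hg'2 : ∀ τ ∈ Icc 0 T, eLpNorm (g' τ) 2 volume ≤ G₂')
    (hE : ∃ C : ℝ≥0∞, C < ⊤ ∧ ∀ t ∈ Icc 0 T, ∫⁻ x, ‖u t x‖ₑ ^ 2 ≤ C)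
    (hE' : ∃ C : ℝ≥0∞, C < ⊤ ∧ ∀ t ∈ Icc 0 T, ∫⁻ x, ‖u' t x‖ₑ ^ 2 ≤ C)
    (hM : 0 < M) (hM' : 0 < M')
    (hbd : ∀ t ∈ Icc 0 T, ∀ y, ‖u t y‖ ≤ M) (hbd' : ∀ t ∈ Icc 0 T, ∀ y, ‖u' t y‖ ≤ M')
    (hTs : (24 * oseenSliceConst (EuclideanSpace ℝ (Fin 3)) * (M + M')) ^ 2 * T ≤ ν)
    (hE₀ : 0 ≤ E₀) (hE0 : eLpNorm (fun y => u' 0 y - u 0 y) 2 volume ≤ ENNReal.ofReal E₀)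
    (hF0 : 0 ≤ F)
    (hF : ∀ t ∈ Ioc 0 T, ∀ x, ‖forceDuhamel ν 0 g' t x - forceDuhamel ν 0 g t x‖ ≤ F) :
    ∀ t ∈ Ioc 0 T, ∀ x, ‖u' t x - u t x‖ ≤
      2 * (E₀ * ν ^ (-(3 / 4 : ℝ)) + F * T ^ (3 / 4 : ℝ)) * t ^ (-(3 / 4 : ℝ)) := by
  -- ### constants
  set C₀ : ℝ := oseenSliceConst (EuclideanSpace ℝ (Fin 3)) with hC₀def
  have hC₀ : 0 < C₀ := oseenSliceConst_pos
  have hMM : 0 < M + M' := add_pos hM hM'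
  -- the key inequality behind the shortness of the slab: `12 C₀ (M+M') ν^{-1/2} T^{1/2} ≤ 1/2`
  have hkey : 12 * C₀ * (M + M') * (ν ^ (-(1 / 2 : ℝ)) * T ^ (1 / 2 : ℝ)) ≤ 1 / 2 := by
    have ha : 0 < 24 * C₀ * (M + M') := by positivity
    have h1 : 24 * C₀ * (M + M') * Real.sqrt T ≤ Real.sqrt ν := by
      have h := Real.sqrt_le_sqrt hTs
      rwa [Real.sqrt_mul (sq_nonneg _), Real.sqrt_sq ha.le] at h
    have hsν : 0 < Real.sqrt ν := Real.sqrt_pos.2 hν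
    have h2 : ν ^ (-(1 / 2 : ℝ)) = (Real.sqrt ν)⁻¹ := by
      rw [Real.rpow_neg hν.le, Real.sqrt_eq_rpow]
    rw [h2, ← Real.sqrt_eq_rpow]
    have h3 : 24 * C₀ * (M + M') * Real.sqrt T * (Real.sqrt ν)⁻¹ ≤ 1 := by
      rw [mul_inv_le_iff₀ hsν, one_mul]; exact h1
    calc 12 * C₀ * (M + M') * ((Real.sqrt ν)⁻¹ * Real.sqrt T)
        = (24 * C₀ * (M + M') * Real.sqrt T * (Real.sqrt ν)⁻¹) / 2 := by ring
      _ ≤ 1 / 2 := by linarith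
  -- ### the difference field and the weighted supremum (weight `τ^{3/4}`)
  set w : ℝ → EuclideanSpace ℝ (Fin 3) → EuclideanSpace ℝ (Fin 3) := fun τ y => u' τ y - u τ y
    with hw_def
  have hwbd : ∀ τ ∈ Icc 0 T, ∀ y, ‖w τ y‖ ≤ M' + M := fun τ hτ y =>
    (norm_sub_le _ _).trans (add_le_add (hbd' τ hτ y) (hbd τ hτ y))
  set S : Set ℝ := {r | ∃ τ ∈ Icc 0 T, ∃ y : EuclideanSpace ℝ (Fin 3),
    r = τ ^ (3 / 4 : ℝ) * ‖w τ y‖} with hS_def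
  have hSbdd : BddAbove S := by
    refine ⟨T ^ (3 / 4 : ℝ) * (M' + M), ?_⟩
    rintro r ⟨τ, hτ, y, rfl⟩
    have hτT : τ ^ (3 / 4 : ℝ) ≤ T ^ (3 / 4 : ℝ) := Real.rpow_le_rpow hτ.1 hτ.2 (by norm_num)
    exact mul_le_mul hτT (hwbd τ hτ y) (norm_nonneg _) (Real.rpow_nonneg hT.le _)
  have h0I : (0 : ℝ) ∈ Icc 0 T := ⟨le_rfl, hT.le⟩
  have hSne : S.Nonempty := ⟨_, 0, h0I, 0, rfl⟩
  set A : ℝ := sSup S with hA_def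
  have hA0 : 0 ≤ A := by
    have hmem : (0 : ℝ) ^ (3 / 4 : ℝ) * ‖w 0 0‖ ∈ S := ⟨0, h0I, 0, rfl⟩
    exact le_trans (mul_nonneg (Real.rpow_nonneg le_rfl _) (norm_nonneg _)) (le_csSup hSbdd hmem)
  have hwS : ∀ τ ∈ Icc 0 T, ∀ y, τ ^ (3 / 4 : ℝ) * ‖w τ y‖ ≤ A := fun τ hτ y =>
    le_csSup hSbdd ⟨τ, hτ, y, rfl⟩
  have hwA : ∀ τ ∈ Ioc 0 T, ∀ y, ‖w τ y‖ ≤ A * τ ^ (-(3 / 4 : ℝ)) := by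
    intro τ hτ y
    have hτ34 : 0 < τ ^ (3 / 4 : ℝ) := Real.rpow_pos_of_pos hτ.1 _
    have h1 := hwS τ ⟨hτ.1.le, hτ.2⟩ y
    have h2 : ‖w τ y‖ ≤ A / τ ^ (3 / 4 : ℝ) := by
      rw [le_div_iff₀ hτ34, mul_comm]; exact h1
    rwa [Real.rpow_neg hτ.1.le, ← div_eq_mul_inv]
  -- ### slab regularity
  have hslc : ∀ τ ∈ Icc 0 T, Continuous (u τ) := fun τ hτ => (hcl.contDiff_velocity hτ).continuous
  have hslc' : ∀ τ ∈ Icc 0 T, Continuous (u' τ) := fun τ hτ =>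
    (hcl'.contDiff_velocity hτ).continuous
  have hmeas : AEStronglyMeasurable (uncurry u)
      ((volume : Measure (ℝ × EuclideanSpace ℝ (Fin 3))).restrict (Ioo 0 T ×ˢ univ)) :=
    (hcl.smooth_velocity.continuousOn.mono (prod_mono Ioo_subset_Icc_self Subset.rfl)).aestronglyMeasurable
      (measurableSet_Ioo.prod MeasurableSet.univ)
  have hmeas' : AEStronglyMeasurable (uncurry u')
      ((volume : Measure (ℝ × EuclideanSpace ℝ (Fin 3))).restrict (Ioo 0 T ×ˢ univ)) :=
    (hcl'.smooth_velocity.continuousOn.mono (prod_mono Ioo_subset_Icc_self Subset.rfl)).aestronglyMeasurable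
      (measurableSet_Ioo.prod MeasurableSet.univ)
  have hmeasw : AEStronglyMeasurable (uncurry w)
      ((volume : Measure (ℝ × EuclideanSpace ℝ (Fin 3))).restrict (Ioo 0 T ×ˢ univ)) :=
    hmeas'.sub hmeas
  have hbdo : ∀ τ ∈ Ioo 0 T, ∀ y, ‖u τ y‖ ≤ M := fun τ hτ => hbd τ ⟨hτ.1.le, hτ.2.le⟩
  have hbdo' : ∀ τ ∈ Ioo 0 T, ∀ y, ‖u' τ y‖ ≤ M' := fun τ hτ => hbd' τ ⟨hτ.1.le, hτ.2.le⟩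
  have hwbdo : ∀ τ ∈ Ioo 0 T, ∀ y, ‖w τ y‖ ≤ M' + M := fun τ hτ => hwbd τ ⟨hτ.1.le, hτ.2.le⟩
  -- the datum gap is in `L²`
  have hw0c : Continuous (w 0) := (hslc' 0 h0I).sub (hslc 0 h0I)
  have hw0mem : MemLp (w 0) 2 volume :=
    ⟨hw0c.aestronglyMeasurable, hE0.trans_lt ENNReal.ofReal_lt_top⟩
  -- ### the pointwise estimate at every `(t, x)` of the slab
  have hpt : ∀ t ∈ Icc 0 T, ∀ x, t ^ (3 / 4 : ℝ) * ‖w t x‖ ≤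
      (E₀ * ν ^ (-(3 / 4 : ℝ)) + F * T ^ (3 / 4 : ℝ)) + A / 2 := by
    intro t ht x
    have hRHS0 : 0 ≤ (E₀ * ν ^ (-(3 / 4 : ℝ)) + F * T ^ (3 / 4 : ℝ)) + A / 2 := by positivity
    rcases ht.1.eq_or_lt with h0 | ht0
    · -- `t = 0`: the weight vanishes
      rw [← h0, Real.zero_rpow (by norm_num), zero_mul]
      exact hRHS0
    have htI : t ∈ Ioc 0 T := ⟨ht0, ht.2⟩
    -- the two representations at time `t`
    have hrep := hcl.ae_eq_forced_oseenMild hν hT hgc hG hgdiv hG₂ hg2 hE hM hbd htI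
    have hrep' := hcl'.ae_eq_forced_oseenMild hν hT hg'c hG' hg'div hG₂' hg'2 hE' hM' hbd' htI
    -- the bilinear terms
    have hνt : 0 < ν * t := mul_pos hν ht0
    have hBsplit : ∀ y, oseenDuhamel ν 0 u' u' t y - oseenDuhamel ν 0 u u t y =
        oseenDuhamel ν 0 u' w t y + oseenDuhamel ν 0 w u t y := by
      intro y
      have h1 := oseenDuhamel_sub_right hν hmeas' hmeas' hmeas hbdo' hbdo' hbdo ht0 ht.2 y
      have h2 := oseenDuhamel_sub_left hν hmeas' hmeas hmeas hbdo' hbdo hbdo ht0 ht.2 y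
      change oseenDuhamel ν 0 u' w t y = _ at h1
      change oseenDuhamel ν 0 w u t y = _ at h2
      rw [h1, h2]; abel
    have hwAo : ∀ τ ∈ Ioo 0 t, ∀ y, ‖w τ y‖ ≤ A * τ ^ (-(3 / 4 : ℝ)) := fun τ hτ =>
      hwA τ ⟨hτ.1, hτ.2.le.trans ht.2⟩
    have hB1 : ∀ y, ‖oseenDuhamel ν 0 u' w t y‖ ≤
        C₀ * ((M' * A) * ν ^ (-(1 / 2 : ℝ)) * (12 * t ^ (-(1 / 4 : ℝ)))) := by
      intro y
      obtain ⟨hIw, hIle⟩ := setIntegral_visc_abelKernel_mul_rpow_threeQuarter_le (K := M' * A) hν ht0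
        (mul_nonneg hM'.le hA0)
      have hint : IntegrableOn
          (fun τ => (ν * (t - τ)) ^ (-(1 / 2 : ℝ)) * (M' * (A * τ ^ (-(3 / 4 : ℝ))))) (Ioo 0 t) :=
        IntegrableOn.congr_fun hIw (fun τ _ => by ring) measurableSet_Ioo
      refine (norm_oseenDuhamel_le_setIntegral_visc hν
        (fun τ hτ => hbdo' τ ⟨hτ.1, hτ.2.trans_le ht.2⟩) hwAo hint y).trans ?_
      have heq : ∫ τ in Ioo 0 t, (ν * (t - τ)) ^ (-(1 / 2 : ℝ)) * (M' * (A * τ ^ (-(3 / 4 : ℝ)))) =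
          ∫ τ in Ioo 0 t, (ν * (t - τ)) ^ (-(1 / 2 : ℝ)) * ((M' * A) * τ ^ (-(3 / 4 : ℝ))) :=
        setIntegral_congr_fun measurableSet_Ioo fun τ _ => by ring
      rw [heq]
      exact mul_le_mul_of_nonneg_left hIle hC₀.le
    have hB2 : ∀ y, ‖oseenDuhamel ν 0 w u t y‖ ≤
        C₀ * ((A * M) * ν ^ (-(1 / 2 : ℝ)) * (12 * t ^ (-(1 / 4 : ℝ)))) := by
      intro y
      obtain ⟨hIw, hIle⟩ := setIntegral_visc_abelKernel_mul_rpow_threeQuarter_le (K := A * M) hν ht0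
        (mul_nonneg hA0 hM.le)
      have hint : IntegrableOn
          (fun τ => (ν * (t - τ)) ^ (-(1 / 2 : ℝ)) * ((A * τ ^ (-(3 / 4 : ℝ))) * M)) (Ioo 0 t) :=
        IntegrableOn.congr_fun hIw (fun τ _ => by ring) measurableSet_Ioo
      refine (norm_oseenDuhamel_le_setIntegral_visc hν hwAo
        (fun τ hτ => hbdo τ ⟨hτ.1, hτ.2.trans_le ht.2⟩) hint y).trans ?_
      have heq : ∫ τ in Ioo 0 t, (ν * (t - τ)) ^ (-(1 / 2 : ℝ)) * ((A * τ ^ (-(3 / 4 : ℝ))) * M) =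
          ∫ τ in Ioo 0 t, (ν * (t - τ)) ^ (-(1 / 2 : ℝ)) * ((A * M) * τ ^ (-(3 / 4 : ℝ))) :=
        setIntegral_congr_fun measurableSet_Ioo fun τ _ => by ring
      rw [heq]
      exact mul_le_mul_of_nonneg_left hIle hC₀.le
    -- the heat term: `L² → L^∞` smoothing of the datum gap
    have hH : ∀ y, ‖UnboundedOperators.heatExtension (u' 0) (ν * t) y -
        UnboundedOperators.heatExtension (u 0) (ν * t) y‖ ≤ E₀ * (ν * t) ^ (-(3 / 4 : ℝ)) := by
      intro y
      rw [← UnboundedOperators.heatExtension_sub_of_bound (hslc' 0 h0I) (hslc 0 h0I) (hbd' 0 h0I)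
        (hbd 0 h0I) hνt y]
      exact norm_heatExtension_le_of_eLpNorm_two hw0mem hE₀ hE0 hνt y
    -- assemble, a.e. in `x`
    set Bt : ℝ := C₀ * ((M' * A) * ν ^ (-(1 / 2 : ℝ)) * (12 * t ^ (-(1 / 4 : ℝ)))) +
      C₀ * ((A * M) * ν ^ (-(1 / 2 : ℝ)) * (12 * t ^ (-(1 / 4 : ℝ)))) with hBt_def
    have hBt : Bt = (12 * C₀ * (M + M') * ν ^ (-(1 / 2 : ℝ))) * t ^ (-(1 / 4 : ℝ)) * A := by
      rw [hBt_def]; ring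
    have hae : ∀ᵐ y ∂(volume : Measure (EuclideanSpace ℝ (Fin 3))),
        ‖w t y‖ ≤ E₀ * (ν * t) ^ (-(3 / 4 : ℝ)) + Bt + F := by
      filter_upwards [hrep, hrep'] with y hy hy'
      have hwy : w t y = (UnboundedOperators.heatExtension (u' 0) (ν * t) y -
            UnboundedOperators.heatExtension (u 0) (ν * t) y) -
          (oseenDuhamel ν 0 u' u' t y - oseenDuhamel ν 0 u u t y) +
          (forceDuhamel ν 0 g' t y - forceDuhamel ν 0 g t y) := by
        show u' t y - u t y = _
        rw [hy, hy']; abel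
      rw [hwy, hBsplit y, hBt_def]
      calc ‖UnboundedOperators.heatExtension (u' 0) (ν * t) y -
              UnboundedOperators.heatExtension (u 0) (ν * t) y -
            (oseenDuhamel ν 0 u' w t y + oseenDuhamel ν 0 w u t y) +
            (forceDuhamel ν 0 g' t y - forceDuhamel ν 0 g t y)‖
          ≤ ‖UnboundedOperators.heatExtension (u' 0) (ν * t) y -
              UnboundedOperators.heatExtension (u 0) (ν * t) y -
            (oseenDuhamel ν 0 u' w t y + oseenDuhamel ν 0 w u t y)‖ +
            ‖forceDuhamel ν 0 g' t y - forceDuhamel ν 0 g t y‖ := norm_add_le _ _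
        _ ≤ (‖UnboundedOperators.heatExtension (u' 0) (ν * t) y -
              UnboundedOperators.heatExtension (u 0) (ν * t) y‖ +
            ‖oseenDuhamel ν 0 u' w t y + oseenDuhamel ν 0 w u t y‖) +
            ‖forceDuhamel ν 0 g' t y - forceDuhamel ν 0 g t y‖ := by
            gcongr; exact norm_sub_le _ _
        _ ≤ (E₀ * (ν * t) ^ (-(3 / 4 : ℝ)) +
            (‖oseenDuhamel ν 0 u' w t y‖ + ‖oseenDuhamel ν 0 w u t y‖)) + F := by
            gcongr
            · exact hH y
            · exact norm_add_le _ _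
            · exact hF t htI y
        _ ≤ (E₀ * (ν * t) ^ (-(3 / 4 : ℝ)) +
            (C₀ * ((M' * A) * ν ^ (-(1 / 2 : ℝ)) * (12 * t ^ (-(1 / 4 : ℝ)))) +
              C₀ * ((A * M) * ν ^ (-(1 / 2 : ℝ)) * (12 * t ^ (-(1 / 4 : ℝ)))))) + F := by
            gcongr
            · exact hB1 y
            · exact hB2 y
        _ = _ := by ring
    have hev : ‖w t x‖ ≤ E₀ * (ν * t) ^ (-(3 / 4 : ℝ)) + Bt + F :=
      forall_norm_le_of_ae_norm_le (f := w t) ((hslc' t ht).sub (hslc t ht)) hae x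
    -- multiply by the weight `t^{3/4}`
    have ht34 : 0 < t ^ (3 / 4 : ℝ) := Real.rpow_pos_of_pos ht0 _
    have hνt34 : (ν * t) ^ (-(3 / 4 : ℝ)) = ν ^ (-(3 / 4 : ℝ)) * t ^ (-(3 / 4 : ℝ)) :=
      Real.mul_rpow hν.le ht0.le
    have hcancel : t ^ (3 / 4 : ℝ) * t ^ (-(3 / 4 : ℝ)) = 1 := by
      rw [← Real.rpow_add ht0, show (3 / 4 : ℝ) + -(3 / 4 : ℝ) = 0 by norm_num, Real.rpow_zero]
    have hhalf : t ^ (3 / 4 : ℝ) * t ^ (-(1 / 4 : ℝ)) = t ^ (1 / 2 : ℝ) := by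
      rw [← Real.rpow_add ht0]; norm_num
    have ht12 : t ^ (1 / 2 : ℝ) ≤ T ^ (1 / 2 : ℝ) := Real.rpow_le_rpow ht0.le ht.2 (by norm_num)
    have ht34le : t ^ (3 / 4 : ℝ) ≤ T ^ (3 / 4 : ℝ) := Real.rpow_le_rpow ht0.le ht.2 (by norm_num)
    have hcoef0 : 0 ≤ 12 * C₀ * (M + M') * ν ^ (-(1 / 2 : ℝ)) := by positivity
    -- the three weighted terms
    have hT1 : t ^ (3 / 4 : ℝ) * (E₀ * (ν * t) ^ (-(3 / 4 : ℝ))) = E₀ * ν ^ (-(3 / 4 : ℝ)) := by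
      rw [hνt34]
      calc t ^ (3 / 4 : ℝ) * (E₀ * (ν ^ (-(3 / 4 : ℝ)) * t ^ (-(3 / 4 : ℝ))))
          = E₀ * ν ^ (-(3 / 4 : ℝ)) * (t ^ (3 / 4 : ℝ) * t ^ (-(3 / 4 : ℝ))) := by ring
        _ = E₀ * ν ^ (-(3 / 4 : ℝ)) := by rw [hcancel, mul_one]
    have hT2 : t ^ (3 / 4 : ℝ) * Bt ≤ A / 2 := by
      rw [hBt]
      calc t ^ (3 / 4 : ℝ) * ((12 * C₀ * (M + M') * ν ^ (-(1 / 2 : ℝ))) * t ^ (-(1 / 4 : ℝ)) * A)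
          = (12 * C₀ * (M + M') * ν ^ (-(1 / 2 : ℝ))) * (t ^ (3 / 4 : ℝ) * t ^ (-(1 / 4 : ℝ))) * A := by
            ring
        _ = (12 * C₀ * (M + M') * ν ^ (-(1 / 2 : ℝ))) * t ^ (1 / 2 : ℝ) * A := by rw [hhalf]
        _ ≤ (12 * C₀ * (M + M') * ν ^ (-(1 / 2 : ℝ))) * T ^ (1 / 2 : ℝ) * A := by gcongr
        _ = (12 * C₀ * (M + M') * (ν ^ (-(1 / 2 : ℝ)) * T ^ (1 / 2 : ℝ))) * A := by ring
        _ ≤ (1 / 2) * A := mul_le_mul_of_nonneg_right hkey hA0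
        _ = A / 2 := by ring
    have hT3 : t ^ (3 / 4 : ℝ) * F ≤ F * T ^ (3 / 4 : ℝ) := by
      rw [mul_comm]; exact mul_le_mul_of_nonneg_left ht34le hF0
    calc t ^ (3 / 4 : ℝ) * ‖w t x‖
        ≤ t ^ (3 / 4 : ℝ) * (E₀ * (ν * t) ^ (-(3 / 4 : ℝ)) + Bt + F) :=
          mul_le_mul_of_nonneg_left hev ht34.le
      _ = t ^ (3 / 4 : ℝ) * (E₀ * (ν * t) ^ (-(3 / 4 : ℝ))) + t ^ (3 / 4 : ℝ) * Bt +
            t ^ (3 / 4 : ℝ) * F := by ring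
      _ ≤ E₀ * ν ^ (-(3 / 4 : ℝ)) + A / 2 + F * T ^ (3 / 4 : ℝ) := by
          rw [hT1]; gcongr
      _ = (E₀ * ν ^ (-(3 / 4 : ℝ)) + F * T ^ (3 / 4 : ℝ)) + A / 2 := by ring
  -- ### the weighted supremum is at most `2 (E₀ ν^{-3/4} + F T^{3/4})`
  have hAle : A ≤ (E₀ * ν ^ (-(3 / 4 : ℝ)) + F * T ^ (3 / 4 : ℝ)) + A / 2 := by
    refine csSup_le hSne ?_
    rintro r ⟨τ, hτ, y, rfl⟩
    exact hpt τ hτ y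
  have hA2 : A ≤ 2 * (E₀ * ν ^ (-(3 / 4 : ℝ)) + F * T ^ (3 / 4 : ℝ)) := by linarith
  -- ### conclusion
  intro t ht x
  calc ‖u' t x - u t x‖ = ‖w t x‖ := rfl
    _ ≤ A * t ^ (-(3 / 4 : ℝ)) := hwA t ht x
    _ ≤ 2 * (E₀ * ν ^ (-(3 / 4 : ℝ)) + F * T ^ (3 / 4 : ℝ)) * t ^ (-(3 / 4 : ℝ)) :=
        mul_le_mul_of_nonneg_right hA2 (Real.rpow_nonneg ht.1.le _)

/-- **`L² → L^∞` smoothing of the gap, forces measured in the sup norm**: under the hypotheses of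
`sup_stability_forced_smoothing_core` with `‖g'(τ,·) − g(τ,·)‖ ≤ Δ` on `[0, T]`, for all
`t ∈ (0, T]` and all `x`: `‖u'(t,x) − u(t,x)‖ ≤ 2 (E₀ ν^{-3/4} + T Δ · T^{3/4}) t^{-3/4}`.
[cite: Leray1934, §19 (3.4)–(3.8)] [cite: LemarieRieusset2016, Thm. 6.1 (6.12) with Prop. 6.5] -/
theorem sup_stability_forced_smoothing (hν : 0 < ν) (hT : 0 < T)
    (hcl : IsClassicalNSSolutionOn (Icc 0 T) ν g u p)
    (hcl' : IsClassicalNSSolutionOn (Icc 0 T) ν g' u' p')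
    (hgc : Continuous (uncurry g)) (hg'c : Continuous (uncurry g'))
    (hG : ∀ τ ∈ Icc 0 T, ∀ y, ‖g τ y‖ ≤ G) (hG' : ∀ τ ∈ Icc 0 T, ∀ y, ‖g' τ y‖ ≤ G')
    (hgdiv : ∀ τ ∈ Icc 0 T, IsWeaklyDivFree (g τ)) (hg'div : ∀ τ ∈ Icc 0 T, IsWeaklyDivFree (g' τ))
    (hG₂ : G₂ ≠ ⊤) (hG₂' : G₂' ≠ ⊤)
    (hg2 : ∀ τ ∈ Icc 0 T, eLpNorm (g τ) 2 volume ≤ G₂)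
    (hg'2 : ∀ τ ∈ Icc 0 T, eLpNorm (g' τ) 2 volume ≤ G₂')
    (hE : ∃ C : ℝ≥0∞, C < ⊤ ∧ ∀ t ∈ Icc 0 T, ∫⁻ x, ‖u t x‖ₑ ^ 2 ≤ C)
    (hE' : ∃ C : ℝ≥0∞, C < ⊤ ∧ ∀ t ∈ Icc 0 T, ∫⁻ x, ‖u' t x‖ₑ ^ 2 ≤ C)
    (hM : 0 < M) (hM' : 0 < M')
    (hbd : ∀ t ∈ Icc 0 T, ∀ y, ‖u t y‖ ≤ M) (hbd' : ∀ t ∈ Icc 0 T, ∀ y, ‖u' t y‖ ≤ M')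
    (hTs : (24 * oseenSliceConst (EuclideanSpace ℝ (Fin 3)) * (M + M')) ^ 2 * T ≤ ν)
    (hE₀ : 0 ≤ E₀) (hE0 : eLpNorm (fun y => u' 0 y - u 0 y) 2 volume ≤ ENNReal.ofReal E₀)
    {Δ : ℝ} (hΔ0 : 0 ≤ Δ) (hΔ : ∀ τ ∈ Icc 0 T, ∀ y, ‖g' τ y - g τ y‖ ≤ Δ) :
    ∀ t ∈ Ioc 0 T, ∀ x, ‖u' t x - u t x‖ ≤
      2 * (E₀ * ν ^ (-(3 / 4 : ℝ)) + T * Δ * T ^ (3 / 4 : ℝ)) * t ^ (-(3 / 4 : ℝ)) := by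
  refine sup_stability_forced_smoothing_core hν hT hcl hcl' hgc hg'c hG hG' hgdiv hg'div hG₂ hG₂'
    hg2 hg'2 hE hE' hM hM' hbd hbd' hTs hE₀ hE0 (by positivity) ?_
  intro t ht x
  have h := norm_forceDuhamel_sub_le_of_continuous hν ht.1.le hgc hg'c
    (fun τ hτ => hG τ ⟨hτ.1.le, hτ.2.le.trans ht.2⟩)
    (fun τ hτ => hG' τ ⟨hτ.1.le, hτ.2.le.trans ht.2⟩)
    (fun τ hτ => hΔ τ ⟨hτ.1.le, hτ.2.le.trans ht.2⟩) x
  exact h.trans (mul_le_mul_of_nonneg_right ht.2 hΔ0)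

/-- **`L² → L^∞` smoothing of the gap between an UNFORCED bounded classical solution and a
solution under a small force measured in `L²`** (the shape consumed by a-posteriori / certificate
arguments: `u` an exact free run, `u'` a pseudo-run driven by its own defect `g'`): `(u, p)`
unforced (`g = 0`) and `(u', p')` forced by `g'` (jointly continuous, bounded, weakly
divergence-free slices with `‖g'(τ)‖₂ ≤ G₂'`), both classical with finite energy on `[0, T] × ℝ³`,
bounded by `M`, `M'`, on a short slab `(24 C₀ (M + M'))² T ≤ ν`; if `‖u'(0,·) − u(0,·)‖₂ ≤ E₀` then
for all `t ∈ (0, T]` and all `x`: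
`‖u'(t,x) − u(t,x)‖ ≤ 2 (E₀ ν^{-3/4} + 4 ν^{-3/4} T^{1/4} G₂' · T^{3/4}) t^{-3/4}`.
[cite: Leray1934, §19 (3.4)–(3.8)] [cite: OzanskiPooley2018, (6.65) p. 143 and Lemma 6.5]
[cite: Kato1984, (2.3)–(2.4')] -/
theorem sup_stability_forced_smoothing_free (hν : 0 < ν) (hT : 0 < T)
    (hcl : IsClassicalNSSolutionOn (Icc 0 T) ν 0 u p)
    (hcl' : IsClassicalNSSolutionOn (Icc 0 T) ν g' u' p')
    (hg'c : Continuous (uncurry g'))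
    (hG' : ∀ τ ∈ Icc 0 T, ∀ y, ‖g' τ y‖ ≤ G')
    (hg'div : ∀ τ ∈ Icc 0 T, IsWeaklyDivFree (g' τ)) {G₂r : ℝ} (hG₂r : 0 ≤ G₂r)
    (hg'2 : ∀ τ ∈ Icc 0 T, eLpNorm (g' τ) 2 volume ≤ ENNReal.ofReal G₂r)
    (hE : ∃ C : ℝ≥0∞, C < ⊤ ∧ ∀ t ∈ Icc 0 T, ∫⁻ x, ‖u t x‖ₑ ^ 2 ≤ C)
    (hE' : ∃ C : ℝ≥0∞, C < ⊤ ∧ ∀ t ∈ Icc 0 T, ∫⁻ x, ‖u' t x‖ₑ ^ 2 ≤ C)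
    (hM : 0 < M) (hM' : 0 < M')
    (hbd : ∀ t ∈ Icc 0 T, ∀ y, ‖u t y‖ ≤ M) (hbd' : ∀ t ∈ Icc 0 T, ∀ y, ‖u' t y‖ ≤ M')
    (hTs : (24 * oseenSliceConst (EuclideanSpace ℝ (Fin 3)) * (M + M')) ^ 2 * T ≤ ν)
    (hE₀ : 0 ≤ E₀) (hE0 : eLpNorm (fun y => u' 0 y - u 0 y) 2 volume ≤ ENNReal.ofReal E₀) :
    ∀ t ∈ Ioc 0 T, ∀ x, ‖u' t x - u t x‖ ≤
      2 * (E₀ * ν ^ (-(3 / 4 : ℝ)) + 4 * ν ^ (-(3 / 4 : ℝ)) * T ^ (1 / 4 : ℝ) * G₂r * T ^ (3 / 4 : ℝ)) *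
        t ^ (-(3 / 4 : ℝ)) := by
  have hgc : Continuous (uncurry (0 : ℝ → EuclideanSpace ℝ (Fin 3) → EuclideanSpace ℝ (Fin 3))) :=
    continuous_const
  have hG : ∀ τ ∈ Icc 0 T, ∀ y,
      ‖(0 : ℝ → EuclideanSpace ℝ (Fin 3) → EuclideanSpace ℝ (Fin 3)) τ y‖ ≤ 0 := fun τ _ y => by simp
  have hgdiv : ∀ τ ∈ Icc 0 T,
      IsWeaklyDivFree ((0 : ℝ → EuclideanSpace ℝ (Fin 3) → EuclideanSpace ℝ (Fin 3)) τ) :=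
    fun τ _ θ _ => by simp
  have hg2 : ∀ τ ∈ Icc 0 T,
      eLpNorm ((0 : ℝ → EuclideanSpace ℝ (Fin 3) → EuclideanSpace ℝ (Fin 3)) τ) 2 volume ≤ (0 : ℝ≥0∞) :=
    fun τ _ => by simp
  have hg'slc : ∀ τ, Continuous (g' τ) := fun τ => hg'c.comp (continuous_const.prodMk continuous_id)
  have hg'mem : ∀ τ ∈ Icc 0 T, MemLp (g' τ) 2 volume := fun τ hτ =>
    ⟨(hg'slc τ).aestronglyMeasurable, (hg'2 τ hτ).trans_lt ENNReal.ofReal_lt_top⟩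
  refine sup_stability_forced_smoothing_core hν hT hcl hcl' hgc hg'c hG hG' hgdiv hg'div
    ENNReal.zero_ne_top ENNReal.ofReal_ne_top hg2 hg'2 hE hE' hM hM' hbd hbd' hTs hE₀ hE0
    (by positivity) ?_
  intro t ht x
  have h0 : forceDuhamel ν 0 (0 : ℝ → EuclideanSpace ℝ (Fin 3) → EuclideanSpace ℝ (Fin 3)) t x = 0 := by
    rw [forceDuhamel_apply]
    have hz : ∀ τ, UnboundedOperators.heatExtension
        ((0 : ℝ → EuclideanSpace ℝ (Fin 3) → EuclideanSpace ℝ (Fin 3)) τ) (ν * (t - τ)) x = 0 := by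
      intro τ
      have : ((0 : ℝ → EuclideanSpace ℝ (Fin 3) → EuclideanSpace ℝ (Fin 3)) τ) =
          fun _ : EuclideanSpace ℝ (Fin 3) => (0 : EuclideanSpace ℝ (Fin 3)) := rfl
      rw [this, UnboundedOperators.heatExtension_zero_fun]; rfl
    simp_rw [hz, integral_zero]
  rw [h0, sub_zero]
  refine (norm_forceDuhamel_le_of_eLpNorm_two hν ht.1 hG₂r
    (fun τ hτ => hg'mem τ ⟨hτ.1.le, hτ.2.le.trans ht.2⟩)
    (fun τ hτ => hg'2 τ ⟨hτ.1.le, hτ.2.le.trans ht.2⟩) x).trans ?_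
  have ht4 : t ^ (1 / 4 : ℝ) ≤ T ^ (1 / 4 : ℝ) := Real.rpow_le_rpow ht.1.le ht.2 (by norm_num)
  have hν34 : 0 ≤ 4 * ν ^ (-(3 / 4 : ℝ)) := by positivity
  gcongr

/-- **`L² → L^∞` smoothing of the gap between two UNFORCED bounded classical solutions** (Leray's
smoothing of an `L²`-small difference into an `L^∞`-small one): `(u, p)`, `(u', p')` classical
unforced solutions with finite energy on `[0, T] × ℝ³`, bounded by `M`, `M'`, on a short slab
`(24 C₀ (M + M'))² T ≤ ν`; if `‖u'(0,·) − u(0,·)‖₂ ≤ E₀` then for all `t ∈ (0, T]` and all `x`: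
`‖u'(t,x) − u(t,x)‖ ≤ 2 E₀ ν^{-3/4} t^{-3/4} = 2 E₀ (ν t)^{-3/4}`.
[cite: Leray1934, §19 (3.4)–(3.8)] [cite: OzanskiPooley2018, (6.65) p. 143 and Lemma 6.5] -/
theorem sup_stability_smoothing_unforced (hν : 0 < ν) (hT : 0 < T)
    (hcl : IsClassicalNSSolutionOn (Icc 0 T) ν 0 u p)
    (hcl' : IsClassicalNSSolutionOn (Icc 0 T) ν 0 u' p')
    (hE : ∃ C : ℝ≥0∞, C < ⊤ ∧ ∀ t ∈ Icc 0 T, ∫⁻ x, ‖u t x‖ₑ ^ 2 ≤ C)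
    (hE' : ∃ C : ℝ≥0∞, C < ⊤ ∧ ∀ t ∈ Icc 0 T, ∫⁻ x, ‖u' t x‖ₑ ^ 2 ≤ C)
    (hM : 0 < M) (hM' : 0 < M')
    (hbd : ∀ t ∈ Icc 0 T, ∀ y, ‖u t y‖ ≤ M) (hbd' : ∀ t ∈ Icc 0 T, ∀ y, ‖u' t y‖ ≤ M')
    (hTs : (24 * oseenSliceConst (EuclideanSpace ℝ (Fin 3)) * (M + M')) ^ 2 * T ≤ ν)
    (hE₀ : 0 ≤ E₀) (hE0 : eLpNorm (fun y => u' 0 y - u 0 y) 2 volume ≤ ENNReal.ofReal E₀) :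
    ∀ t ∈ Ioc 0 T, ∀ x, ‖u' t x - u t x‖ ≤ 2 * (E₀ * ν ^ (-(3 / 4 : ℝ))) * t ^ (-(3 / 4 : ℝ)) := by
  have hgc : Continuous (uncurry (0 : ℝ → EuclideanSpace ℝ (Fin 3) → EuclideanSpace ℝ (Fin 3))) :=
    continuous_const
  have hG : ∀ τ ∈ Icc 0 T, ∀ y,
      ‖(0 : ℝ → EuclideanSpace ℝ (Fin 3) → EuclideanSpace ℝ (Fin 3)) τ y‖ ≤ 0 := fun τ _ y => by simp
  have hgdiv : ∀ τ ∈ Icc 0 T,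
      IsWeaklyDivFree ((0 : ℝ → EuclideanSpace ℝ (Fin 3) → EuclideanSpace ℝ (Fin 3)) τ) :=
    fun τ _ θ _ => by simp
  have hg2 : ∀ τ ∈ Icc 0 T,
      eLpNorm ((0 : ℝ → EuclideanSpace ℝ (Fin 3) → EuclideanSpace ℝ (Fin 3)) τ) 2 volume ≤ (0 : ℝ≥0∞) :=
    fun τ _ => by simp
  have h := sup_stability_forced_smoothing_core (F := 0) hν hT hcl hcl' hgc hgc hG hG hgdiv hgdiv
    ENNReal.zero_ne_top ENNReal.zero_ne_top hg2 hg2 hE hE' hM hM' hbd hbd' hTs hE₀ hE0 le_rfl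
    (fun t _ x => by rw [sub_self, norm_zero])
  intro t ht x
  have h' := h t ht x
  rwa [zero_mul, add_zero] at h'

end Core

/-! ### The terminal-window form (time translation) -/

section Window

variable {ν T s M M' Es : ℝ}
  {g' u u' : ℝ → EuclideanSpace ℝ (Fin 3) → EuclideanSpace ℝ (Fin 3)}
  {p p' : ℝ → EuclideanSpace ℝ (Fin 3) → ℝ} {G' : ℝ}

/-- **`L² → L^∞` smoothing on a SHORT TERMINAL WINDOW `[s, T]` of a long slab** (the form a
certificate argument consumes: the `L²` gap at time `s`, obtained cheaply over the long window
`[0, s]`, is upgraded to a sup-norm gap on `(s, T]`): `(u, p)` unforced and `(u', p')` forced by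
`g'` (jointly continuous, bounded, weakly divergence-free slices, `‖g'(τ)‖₂ ≤ G₂'`), both
classical with finite energy on `[0, T] × ℝ³` and bounded by `M`, `M'`; `0 ≤ s < T` with
`(24 C₀ (M + M'))² (T − s) ≤ ν`; if `‖u'(s,·) − u(s,·)‖₂ ≤ E_s` then for all `t ∈ (s, T]` and
all `x`:
`‖u'(t,x) − u(t,x)‖ ≤ 2 (E_s ν^{-3/4} + 4 ν^{-3/4} (T−s)^{1/4} G₂' · (T−s)^{3/4}) (t − s)^{-3/4}`
(`sup_stability_forced_smoothing_free` for the time-translated solutions,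
`IsClassicalNSSolutionOn.comp_add_right`).
[cite: Leray1934, §19 (3.4)–(3.8)] [cite: OzanskiPooley2018, (6.65) p. 143 and Lemma 6.5] -/
theorem sup_stability_forced_smoothing_free_window (hν : 0 < ν) (hs0 : 0 ≤ s) (hsT : s < T)
    (hcl : IsClassicalNSSolutionOn (Icc 0 T) ν 0 u p)
    (hcl' : IsClassicalNSSolutionOn (Icc 0 T) ν g' u' p')
    (hg'c : Continuous (uncurry g'))
    (hG' : ∀ τ ∈ Icc 0 T, ∀ y, ‖g' τ y‖ ≤ G')
    (hg'div : ∀ τ ∈ Icc 0 T, IsWeaklyDivFree (g' τ)) {G₂r : ℝ} (hG₂r : 0 ≤ G₂r)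
    (hg'2 : ∀ τ ∈ Icc 0 T, eLpNorm (g' τ) 2 volume ≤ ENNReal.ofReal G₂r)
    (hE : ∃ C : ℝ≥0∞, C < ⊤ ∧ ∀ t ∈ Icc 0 T, ∫⁻ x, ‖u t x‖ₑ ^ 2 ≤ C)
    (hE' : ∃ C : ℝ≥0∞, C < ⊤ ∧ ∀ t ∈ Icc 0 T, ∫⁻ x, ‖u' t x‖ₑ ^ 2 ≤ C)
    (hM : 0 < M) (hM' : 0 < M')
    (hbd : ∀ t ∈ Icc 0 T, ∀ y, ‖u t y‖ ≤ M) (hbd' : ∀ t ∈ Icc 0 T, ∀ y, ‖u' t y‖ ≤ M')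
    (hTs : (24 * oseenSliceConst (EuclideanSpace ℝ (Fin 3)) * (M + M')) ^ 2 * (T - s) ≤ ν)
    (hEs0 : 0 ≤ Es) (hEs : eLpNorm (fun y => u' s y - u s y) 2 volume ≤ ENNReal.ofReal Es) :
    ∀ t ∈ Ioc s T, ∀ x, ‖u' t x - u t x‖ ≤
      2 * (Es * ν ^ (-(3 / 4 : ℝ)) +
          4 * ν ^ (-(3 / 4 : ℝ)) * (T - s) ^ (1 / 4 : ℝ) * G₂r * (T - s) ^ (3 / 4 : ℝ)) *
        (t - s) ^ (-(3 / 4 : ℝ)) := by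
  have hTs' : 0 < T - s := sub_pos.2 hsT
  -- the translated solutions on `[0, T - s]`
  have hmem : ∀ τ ∈ Icc 0 (T - s), τ + s ∈ Icc 0 T := fun τ hτ =>
    ⟨by linarith [hτ.1], by linarith [hτ.2]⟩
  have hUD : UniqueDiffOn ℝ (Icc 0 (T - s)) := uniqueDiffOn_Icc hTs'
  have hclT : IsClassicalNSSolutionOn (Icc 0 (T - s)) ν 0 (fun t => u (t + s)) (fun t => p (t + s)) :=
    (hcl.comp_add_right s).mono (fun t ht => hmem t ht) hUD
  have hclT' : IsClassicalNSSolutionOn (Icc 0 (T - s)) ν (fun t => g' (t + s)) (fun t => u' (t + s))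
      (fun t => p' (t + s)) :=
    (hcl'.comp_add_right s).mono (fun t ht => hmem t ht) hUD
  have hg'cT : Continuous (uncurry fun t => g' (t + s)) :=
    hg'c.comp ((continuous_fst.add continuous_const).prodMk continuous_snd)
  have hG'T : ∀ τ ∈ Icc 0 (T - s), ∀ y, ‖g' (τ + s) y‖ ≤ G' := fun τ hτ => hG' _ (hmem τ hτ)
  have hg'divT : ∀ τ ∈ Icc 0 (T - s), IsWeaklyDivFree (g' (τ + s)) := fun τ hτ =>
    hg'div _ (hmem τ hτ)
  have hg'2T : ∀ τ ∈ Icc 0 (T - s), eLpNorm (g' (τ + s)) 2 volume ≤ ENNReal.ofReal G₂r :=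
    fun τ hτ => hg'2 _ (hmem τ hτ)
  have hET : ∃ C : ℝ≥0∞, C < ⊤ ∧ ∀ t ∈ Icc 0 (T - s), ∫⁻ x, ‖u (t + s) x‖ₑ ^ 2 ≤ C := by
    obtain ⟨C, hC, h⟩ := hE
    exact ⟨C, hC, fun t ht => h _ (hmem t ht)⟩
  have hET' : ∃ C : ℝ≥0∞, C < ⊤ ∧ ∀ t ∈ Icc 0 (T - s), ∫⁻ x, ‖u' (t + s) x‖ₑ ^ 2 ≤ C := by
    obtain ⟨C, hC, h⟩ := hE'
    exact ⟨C, hC, fun t ht => h _ (hmem t ht)⟩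
  have hbdT : ∀ t ∈ Icc 0 (T - s), ∀ y, ‖u (t + s) y‖ ≤ M := fun t ht => hbd _ (hmem t ht)
  have hbdT' : ∀ t ∈ Icc 0 (T - s), ∀ y, ‖u' (t + s) y‖ ≤ M' := fun t ht => hbd' _ (hmem t ht)
  have hEsT : eLpNorm (fun y => u' (0 + s) y - u (0 + s) y) 2 volume ≤ ENNReal.ofReal Es := by
    simpa only [zero_add] using hEs
  have h := sup_stability_forced_smoothing_free hν hTs' hclT hclT' hg'cT hG'T hg'divT hG₂r hg'2T
    hET hET' hM hM' hbdT hbdT' hTs hEs0 hEsT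
  intro t ht x
  have htI : t - s ∈ Ioc 0 (T - s) := ⟨sub_pos.2 ht.1, by linarith [ht.2]⟩
  have h' := h (t - s) htI x
  simpa only [sub_add_cancel] using h'

end Window

end Literature.Analysis.FluidPDE

end
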